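import Summits.HodgeConjecture.HodgeConjecture.Theses.TateCuspKLift

/-!
# Route TateCuspKLift — `EngineGlue` (glue item stmt-HodgeConjecture-9316)

`ArithmeticTateRestriction → KClassPropagates → CuspAccessibleHodge`: for an absolute Hodge class `ξ`
on the total space of a family over a curve with a ℚ̄-Tate cusp `o`, the first crux puts `ξ|_o` in
the span of pull-backs of algebraic classes, and the second propagates this to algebraicity of `ξ|_t`
on every smooth projective fibre; an absolute Hodge class is rational and of type `(p, p)`
(`IsAbsoluteHodgeClass.1`, `.2.1`).  Pure logic over the route file; no other import, no named-fact
hypothesis, no sorry.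
-/

-- `Summit.HodgeConjecture.HodgeConjecture.Theorems` is the mandated namespace (single-problem
-- summit: Problem = Summit), which `linter.dupNamespace` flags on every declaration; the lakefile
-- turns the linter off tree-wide (weak option), restated here so stand-alone elaboration is
-- warning-free too.
set_option linter.dupNamespace false

namespace Summit.HodgeConjecture.HodgeConjecture.Theorems

/-- **Item stmt-HodgeConjecture-9316 (`EngineGlue`), route `TateCuspKLift`**: `KClassPropagates`
applied to the output of `ArithmeticTateRestriction` (the class being rational and `(p,p)` as an
absolute Hodge class). [cite: Deligne1982HodgeCycles, §2] -/
theorem tateCuspKLift_engineGlue_proof :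
    Summit.HodgeConjecture.HodgeConjecture.Theses.TateCuspKLift.EngineGlue :=
  fun h₁ h₂ N p 𝒳 C f o hN hC hcusp ξ hξ t n ht ↦
    h₂ N p 𝒳 C f o hN hC ξ hξ.1 hξ.2.1 (h₁ N p 𝒳 C f o hN hC hcusp ξ hξ) t n ht

end Summit.HodgeConjecture.HodgeConjecture.Theorems
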